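import Summits.Langlands.Langlands.Theorems.ParityBlindBianchiArtinWeightRealisationEvenStubAdNormalFrame
import Summits.Langlands.Langlands.Theorems.ParityBlindBianchiArtinWeightRealisationEvenStubTwistOfAdNormalForm
import HarnessLib

/-!
# Twist-conjugacy from the adjoint trace identity — the general-twist pinning of the line `SketchIdeator2`
# for the crux `ParityBlindBianchi.ArtinWeightRealisationEven` (item stmt-Langlands-16619), composed

Helper file (`--supports stmt-Langlands-16619`, registered sub-goal `twistConjugate_of_adTraces`).  Pure algebra.
Let `Γ` be a group, `A` an algebraically closed field of characteristic `0`, `σ r : Γ → GL₂(A)` homomorphisms with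
finite images, `σ` of projective image `A₅`, and suppose the ADJOINT TRACE IDENTITY
`tr(r g)² · det σ(g) = tr(σ g)² · det r(g)` for all `g` (i.e. `tr Ad⁰ r = tr Ad⁰ σ` pointwise).  Then
`r = χ · M σ M⁻¹` for a character `χ : Γ → Aˣ` and some `M ∈ GL₂(A)` — and `χ` has finite range.  This is the
composite of the landed stubs `stub_adNormalFrame` (S4ad-frame, p164535: simultaneous dihedral normal frames) and
`stub_twistOfAdNormalForm` (S4ad-twist, p164567: the normal form forces the twist), conjugated back; it
generalises the sign case `stub_twistConjugateOfSignedTraces` (p154688: `det r = det σ`, `tr r = ± tr σ` ⇒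
`χ² = 1`) and is what lets the open stub S1 of the line ask only for ADJOINT compatibility.  ELEMENTARY (no
character theory): dihedral normal form on `D₅ ⊂ A₅`, Vandermonde sign lemma with a square root
`δ² = det R / det Q`, "a group is not the union of two proper subgroups".

* `adTraces_conj` — the identity is invariant under conjugating `σ` and `r` by different frames;
* `twistConjugate_of_adTraces` — the pinning;
* `finite_range_of_twistConjugate` — `χ` has finite range when `σ` and `r` have.

No definition, no named fact.
-/

-- the line's namespace `Summit.Langlands.Langlands.…` (summit = problem = `Langlands`) repeats a
-- component by design
set_option linter.dupNamespace false

namespace Summit.Langlands.Langlands.Theorems.ArtinWeightRealisationEven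

open scoped MatrixGroups Matrix

universe u v

/-- The adjoint trace identity is invariant under conjugating `σ` and `r` by (different) frames. -/
theorem adTraces_conj {Γ : Type u} [Group Γ] {A : Type v} [Field A] (σ r : Γ →* GL (Fin 2) A)
    (U V : GL (Fin 2) A)
    (had : ∀ g : Γ, Matrix.trace ((r g : GL (Fin 2) A) : Matrix (Fin 2) (Fin 2) A) ^ 2 * Matrix.det ((σ g : GL (Fin 2) A) : Matrix (Fin 2) (Fin 2) A) = Matrix.trace ((σ g : GL (Fin 2) A) : Matrix (Fin 2) (Fin 2) A) ^ 2 * Matrix.det ((r g : GL (Fin 2) A) : Matrix (Fin 2) (Fin 2) A)) :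
    ∀ g : Γ, Matrix.trace ((((MulAut.conj V).toMonoidHom.comp r) g : GL (Fin 2) A) : Matrix (Fin 2) (Fin 2) A) ^ 2 *
        Matrix.det ((((MulAut.conj U).toMonoidHom.comp σ) g : GL (Fin 2) A) : Matrix (Fin 2) (Fin 2) A) =
      Matrix.trace ((((MulAut.conj U).toMonoidHom.comp σ) g : GL (Fin 2) A) : Matrix (Fin 2) (Fin 2) A) ^ 2 *
        Matrix.det ((((MulAut.conj V).toMonoidHom.comp r) g : GL (Fin 2) A) : Matrix (Fin 2) (Fin 2) A) := by
  intro g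
  simp only [MonoidHom.coe_comp, MulEquiv.coe_toMonoidHom, Function.comp_apply, MulAut.conj_apply,
    Units.val_mul, Matrix.trace_units_conj, Matrix.det_units_conj]
  exact had g

/-- **Twist-conjugacy from the adjoint trace identity** (S4ad-frame + S4ad-twist, conjugated back): for
`σ r : Γ → GL₂(A)` with finite images over an algebraically closed field of characteristic `0`, `σ` projectively
`A₅`, `tr(r g)² det σ(g) = tr(σ g)² det r(g)` for all `g` forces `r = χ · M σ M⁻¹` for a character `χ`. -/
theorem twistConjugate_of_adTraces :
    ∀ (Γ : Type u) [Group Γ] (A : Type v) [Field A] [IsAlgClosed A] [CharZero A] (σ r : Γ →* GL (Fin 2) A), Finite σ.range → Finite r.range → Nonempty ((Matrix.ProjGenLinGroup.mk.comp σ).range ≃* alternatingGroup (Fin 5)) → (∀ g : Γ, Matrix.trace ((r g : GL (Fin 2) A) : Matrix (Fin 2) (Fin 2) A) ^ 2 * Matrix.det ((σ g : GL (Fin 2) A) : Matrix (Fin 2) (Fin 2) A) = Matrix.trace ((σ g : GL (Fin 2) A) : Matrix (Fin 2) (Fin 2) A) ^ 2 * Matrix.det ((r g : GL (Fin 2) A)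 : Matrix (Fin 2) (Fin 2) A)) → ∃ (χ : Γ →* Aˣ) (M : GL (Fin 2) A), ∀ g : Γ, ((r g : GL (Fin 2) A) : Matrix (Fin 2) (Fin 2) A) = ((χ g : Aˣ) : A) • ((M * σ g * M⁻¹ : GL (Fin 2) A) : Matrix (Fin 2) (Fin 2) A) := by
  intro Γ _ A _ _ _ σ r hσ hr hA5 had
  obtain ⟨U, V, g₅, s, l₁, l₂, b, ε₁, ε₂, h1, h2, hne, hsq, hb, he1, he2, hS5, hSs, hR5, hRs⟩ :=
    stub_adNormalFrame Γ A σ r hσ hr hA5 had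
  set σ' : Γ →* GL (Fin 2) A := (MulAut.conj U).toMonoidHom.comp σ with hσ'def
  set r' : Γ →* GL (Fin 2) A := (MulAut.conj V).toMonoidHom.comp r with hr'def
  have hσ' : ∀ g, σ' g = U * σ g * U⁻¹ := fun g => rfl
  have hr' : ∀ g, r' g = V * r g * V⁻¹ := fun g => rfl
  obtain ⟨χ, M, hχ⟩ := stub_twistOfAdNormalForm Γ A σ' r' (adTraces_conj σ r U V had) g₅ s l₁ l₂ b ε₁ ε₂
    h1 h2 hne hsq hb he1 he2 (by rw [hσ']; exact hS5) (by rw [hσ']; exact hSs) (by rw [hr']; exact hR5)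
    (by rw [hr']; exact hRs)
  refine ⟨χ, V⁻¹ * M * U, fun g => ?_⟩
  have key := hχ g
  rw [hr', hσ'] at key
  -- `V r V⁻¹ = χ • M U σ U⁻¹ M⁻¹`; conjugate by `V⁻¹`
  have h2 : ((r g : GL (Fin 2) A) : Matrix (Fin 2) (Fin 2) A) =
      ((V⁻¹ : GL (Fin 2) A) : Matrix (Fin 2) (Fin 2) A) * ((V * r g * V⁻¹ : GL (Fin 2) A) : Matrix (Fin 2) (Fin 2) A) * ((V : GL (Fin 2) A) : Matrix (Fin 2) (Fin 2) A) := by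
    simp only [Units.val_mul, ← Matrix.mul_assoc, Units.inv_mul, Matrix.one_mul]
    rw [Matrix.mul_assoc, Units.inv_mul, Matrix.mul_one]
  rw [h2, key, Matrix.mul_smul, Matrix.smul_mul]
  congr 1
  simp only [Units.val_mul, mul_inv_rev, inv_inv, Matrix.mul_assoc]

/-- A character `χ` with `r = χ · M σ M⁻¹` has finite range when `σ` and `r` have. -/
theorem finite_range_of_twistConjugate {Γ : Type u} [Group Γ] {A : Type v} [Field A] (σ r : Γ →* GL (Fin 2) A)
    (hσ : Finite σ.range) (hr : Finite r.range) (χ : Γ →* Aˣ) (M : GL (Fin 2) A)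
    (hχ : ∀ g : Γ, ((r g : GL (Fin 2) A) : Matrix (Fin 2) (Fin 2) A) = ((χ g : Aˣ) : A) • ((M * σ g * M⁻¹ : GL (Fin 2) A) : Matrix (Fin 2) (Fin 2) A)) :
    Finite χ.range := by
  -- `χ g` is the `(0,0)` entry of `r g · (M σ g M⁻¹)⁻¹`, a function of the pair `(r g, σ g)`
  have hval : ∀ g : Γ, ((χ g : Aˣ) : A) =
      (((r g : GL (Fin 2) A) : Matrix (Fin 2) (Fin 2) A) * (((M * σ g * M⁻¹)⁻¹ : GL (Fin 2) A) : Matrix (Fin 2) (Fin 2) A)) 0 0 := by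
    intro g
    rw [hχ g, Matrix.smul_mul, ← Units.val_mul, mul_inv_cancel, Units.val_one, Matrix.smul_apply,
      Matrix.one_apply_eq, smul_eq_mul, mul_one]
  haveI : Finite (σ.range × r.range) := inferInstance
  let f : σ.range × r.range → A := fun x =>
    (((x.2 : GL (Fin 2) A) : Matrix (Fin 2) (Fin 2) A) * (((M * (x.1 : GL (Fin 2) A) * M⁻¹)⁻¹ : GL (Fin 2) A) : Matrix (Fin 2) (Fin 2) A)) 0 0
  have hsub : Set.range (fun g : Γ => ((χ g : Aˣ) : A)) ⊆ Set.range f := by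
    rintro _ ⟨g, rfl⟩
    exact ⟨(⟨σ g, g, rfl⟩, ⟨r g, g, rfl⟩), (hval g).symm⟩
  have hfin : (Set.range (fun g : Γ => ((χ g : Aˣ) : A))).Finite := (Set.finite_range f).subset hsub
  have hfin' : (Set.range (fun g : Γ => χ g)).Finite := by
    have : Set.range (fun g : Γ => ((χ g : Aˣ) : A)) = (Units.val) '' Set.range (fun g : Γ => χ g) := by
      rw [← Set.range_comp]; rfl
    rw [this] at hfin
    exact hfin.of_finite_image Units.val_injective.injOn
  have : (χ.range : Set Aˣ) = Set.range (fun g : Γ => χ g) := MonoidHom.coe_range χ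
  exact Set.finite_coe_iff.mpr (this ▸ hfin')

end Summit.Langlands.Langlands.Theorems.ArtinWeightRealisationEven
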